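import Summits.QuantumFields.BalabanUV.Beta.FP.WardSandwichEngine
import Summits.QuantumFields.BalabanUV.Beta.FP.PerfectPropagatorInverse
import Summits.QuantumFields.BalabanUV.Beta.FP.PerfectPolarizationWard
import Literature.Probability.LatticeModels.LatticeGreenPoisson

/-!
# `BalabanUV.Beta.FP.PerfectPolarizationWardLetters` — road «FP» for binder row D1, sub-row H2-ASM-5a «layer b», part 2∕2 (completion of the in-flight W2 under R-FP-33 (b);
# owner b2b-balaban-beta-d1-p3 l.26457: «(W1) ⟸ (a4) `divV V 0 = c·(MF∘Π₀ − Π₀∘MF)` + (P-INV) … with `X y = −c·Π_y`; (G-INV) `comp G0ker (−Δ) = id` is lit1's `latticeGreen`»):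
# THE WARD LETTER (W1) OF `FP/PerfectPolarizationWard.wardTransversal_flip_PiBF` DISCHARGED IN BOTH SECTORS — gluon via (P-INV) ✓ (`FP/PerfectPropagatorInverse.pInv`),
# ghost via (G-INV) proved here from `LatticeGreenPoisson.latticeLaplacianZd_half_latticeGreen` — leaving the GAUGE-COMMUTATOR LAWS (a4-total)∕(a8) as the vertex letters

HONEST DEPENDENCY (page 1, mandatory): continuum YM on T⁴ ⇐ BetaPertH ∧ nine spine estimates (0/9 proved); BetaPertH ⇐ (D1) ∧ (D4) ∧ CAP+tail;
G-an2-4 gates asym, D1 and NE2/3/4.  HONEST FRAMING (cell contract, verbatim): «discharging `BetaPertH` makes Bałaban's UV stability UNCONDITIONAL —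
a real constructive-QFT result; it is NOT the continuum limit and NOT the Clay problem.»  THIS MODULE DISCHARGES NOTHING of the wall: it instantiates part 1's
`sandwich_commutator` at the road's EXPLICIT legs.  [our object] data defs `fmask`, `proj`, `lapKer`, `projU`; no `def … : Prop`; nothing cited as a hypothesis (lit1's Poisson
equation [Lawler1991 §1.5] is a TREE THEOREM used by name); 0 sorry; 0∕4 row-D1 binders; NOT (a4-total)∕(a8) themselves (they are the H2V-4 letters of the perfect action's jets —
the one modelling row of leaf (H2) — and, for the BF-slice∕ghost stencils, explicit finite computations not done here), NOT (K0) (✓ owner p247982 under W2's letters), NOT hgerm,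
NOT D1, NOT BetaPertH, NOT continuum, NOT Clay.  «not in print; our bookkeeping over the road's own `k = ∞` objects».

ABSOLUTE RULE (cell charter, verbatim): «No internally-minted statement may enter as a cited fact. Every hypothesis is either kernel-proved in this package or a
verbatim quotation of a PUBLISHED theorem with page reference. The manuscript(s) under audit are NOT citable for their own disputed steps — they are the thing
under adjudication; programme-internal (2001/route/tribunal) claims are never citable.»

CONTENT (lattice dimension `4`, packed fibre `Fib 3` ∕ scalar fibre `Unit`).
* §4 [our object] GLUON: `fmask` (1 on field, 0 on multiplier indices; `fmask_mul_self`), **`proj y := projM fmask y`** (the colour-stripped infinitesimal gauge generator at `y`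
  acts on the fluctuation 1-forms at their starting site), `biLoc_proj`, `idF_eq_idM : PerfectPropagatorInverse.idF = idM fmask`, `comp_Pker_MF_idM` ∕ `comp_MF_Pker_idM`
  ((P-INV) ✓ in masked currency), **`w1_gluon`**: `(Pker ∘ c·(MF ∘ Π_y − Π_y ∘ MF)) ∘ Pker = Pker ∘ (−c·Π_y) − (−c·Π_y) ∘ Pker`, **`w1_of_gauge_law`** ((a4-total) ⟹ (W1)).
* §5 [our object] GHOST: **`lapKer`** (`−Δ` on scalars as a kernel: `8·[z = y] − Σ_i ([z = y + e_i] + [z = y − e_i])`), `lapKer_symm`, `decays_lapKer` (ultra-local ⟹ `Decays lapKer (16e^δ) δ`),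
  `tsum_mul_lapKer` ∕ `tsum_lapKer_mul` (its action on either side, any function), **`gInv : comp G0ker lapKer = idM 1 ∧ comp lapKer G0ker = idM 1`** ((G-INV) — lit1's
  `latticeLaplacianZd_half_latticeGreen`: `Δ(latticeGreen∕2) = −δ₀` on `ℤ⁴`, `G0ker x z = latticeGreen (z − x)∕2`), **`w1_ghost`**.
* §6 `projU`, `biLoc_smul`, and **`wardTransversal_flip_PiBF_of_gauge_laws`**: `WardTransversal (fun μ ν z => PiBF wg wgh V W v w μ ν (−z))` for vertex data bi-localised at the
  unit-lattice bonds, translation covariant, with (a4-total) `divV V y = c • (comp MF (proj y) − comp (proj y) MF)`, (a8) `divW W y ν y′ = comp ((−c) • proj y) (V ν y′) −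
  comp (V ν y′) ((−c) • proj y)`, and the ghost twins against `lapKer`∕`projU` — W2 `wardTransversal_flip_PiBF` with its letters (W1)∕(W1g) SUPPLIED by `w1_of_gauge_law`∕`w1_ghost`.
WHAT (a4-total) SAYS (for the H2V-4 prover): the gauge variation at site `y` of the TOTAL quadratic form `MF(B)` (perfect action Hessian + `ξ = 1` background-covariant slice) is its
commutator with the generator — exact background-gauge covariance differentiated once at `B = 𝟙`; (a8) is the same differentiated twice.  Nothing about `S_∞` is asserted here.
Provenance: G-an2-4 formalisation swarm seat b2b-balaban-gan24-formalise-leaf-02 gen 40 (prover-b2b-balaban-gan24-formalise-leaf-02-g40-0; cross-lane on road FP), 2026-08-21.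
-/

noncomputable section

namespace Summit.QuantumFields.BalabanUV.Beta.FP.PerfectPolarizationWardLetters

open Finset
open scoped BigOperators
open Literature.MathematicalPhysics.QuantumFieldTheory.Balaban1983to89
open Literature.MathematicalPhysics.QuantumFieldTheory.Balaban1983to89.Beta
open B12Sec2to5 (l1 l1_nonneg)
open ExpKernelCalculus (MKer Site comp Decays BiLoc summable_exp_shift l1_sub_symm)
open KernelWard (Bdd comp_sub_right comp_sub_left)
open Summit.QuantumFields.BalabanUV.Beta.FP.WardSandwichEngine (projM idM projM_apply idM_apply biLoc_projM comp_projM projM_comp idM_comp comp_idM comp_smul_right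
  comp_smul_left sandwich_commutator)

variable {D : ℕ} {Φ : Type*} [Fintype Φ] [DecidableEq Φ]

/-! ## §4 [our object] The gluon instance: `A := Pker`, `M := MF`, mask = the field block -/

section Gluon

open OneStepResolventKernel (Fib)
open B5Symbol166Strip (kappa166 kappa166_pos)
open Summit.QuantumFields.BalabanUV.Beta.FP.PerfectPolarization (Pker Pker_inl_inl Pker_inl_inr Pker_inr_inl Pker_inr_inr)
open Summit.QuantumFields.BalabanUV.Beta.FP.PerfectPolarizationWard (bdd_Pker)
open KernelWard (divV)
open Summit.QuantumFields.BalabanUV.Beta.FP.PerfectPropagatorInverse (MF idF idF_inl_inl idF_inl_inr idF_inr_inl idF_inr_inr comp_Pker_MF comp_MF_Pker decays_MF)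

/-- [our object] THE FIELD-BLOCK MASK on the packed fibre: `1` on field indices, `0` on multiplier indices. -/
def fmask : Fib 3 → ℝ := fun a => match a with
  | Sum.inl _ => 1
  | Sum.inr _ => 0

/-- [our object] `fmask (inl α) = 1`. -/
@[simp] theorem fmask_inl (α : Fin 4) : fmask (Sum.inl α) = 1 := rfl

/-- [our object] `fmask (inr α) = 0`. -/
@[simp] theorem fmask_inr (α : Fin 4) : fmask (Sum.inr α) = 0 := rfl

/-- [our object] the mask is idempotent. -/
theorem fmask_mul_self (a : Fib 3) : fmask a * fmask a = fmask a := by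
  rcases a with α | α <;> simp

/-- [our object] `|fmask a| ≤ 1`. -/
theorem abs_fmask_le (a : Fib 3) : |fmask a| ≤ 1 := by
  rcases a with α | α <;> simp

/-- [our object] **THE SITE PROJECTION OF THE ROAD**: `Π y := projM fmask y` — the identity on the four field components of the bonds starting at `y`, zero elsewhere
(the colour-stripped infinitesimal gauge generator at `y` acts on the fluctuation 1-forms at their starting site). -/
def proj (y : Site 4) : MKer 4 (Fib 3) := projM fmask y

/-- [our object] `proj y = projM fmask y`. -/
theorem proj_def (y : Site 4) : proj y = projM fmask y := rfl

/-- [our object] `proj y` is bi-localised at `(y, y)` with constant `1`, at every rate. -/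
theorem biLoc_proj (y : Site 4) (δ : ℝ) : BiLoc (proj y) y y 1 δ := biLoc_projM abs_fmask_le y δ

/-- [our object] the field-block identity of `FP/PerfectPropagatorInverse` IS the masked identity of this file: `idF = idM fmask`. -/
theorem idF_eq_idM : (idF : MKer 4 (Fib 3)) = idM fmask := by
  funext x z a b
  rw [idM_apply]
  rcases a with γ | γ <;> rcases b with β | β
  · rw [idF_inl_inl]
    by_cases h : x = z
    · subst h; simp
    · have h' : ¬ (z - x = 0) := fun e => h (sub_eq_zero.mp e).symm
      simp [h, h']
  · simp [idF_inl_inr]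
  · simp [idF_inr_inl]
  · rw [idF_inr_inr]
    split_ifs <;> simp

/-- [our object] (P-INV) in masked currency: `Pker ∘ MF = idM fmask`. -/
theorem comp_Pker_MF_idM : comp Pker MF = idM fmask := by rw [comp_Pker_MF, idF_eq_idM]

/-- [our object] (P-INV) in masked currency: `MF ∘ Pker = idM fmask`. -/
theorem comp_MF_Pker_idM : comp MF Pker = idM fmask := by rw [comp_MF_Pker, idF_eq_idM]

/-- [our object] **(W1) FOR THE GLUON SECTOR FROM THE COMMUTATOR LAW.**  For every constant `c` and site `y`:
`(Pker ∘ c·(MF ∘ Π_y − Π_y ∘ MF)) ∘ Pker = Pker ∘ (−c·Π_y) − (−c·Π_y) ∘ Pker`.  So a vertex family whose gauge divergence is the commutator of the perfect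
Feynman form with the site projection ((a4) in TOTAL form) satisfies W2's letter (W1) with the generator `X y = −c·Π_y`. -/
theorem w1_gluon (c : ℝ) (y : Site 4) :
    comp (comp Pker (c • (comp MF (proj y) - comp (proj y) MF))) Pker = comp Pker ((-c) • proj y) - comp ((-c) • proj y) Pker := by
  obtain ⟨C, _, hC⟩ := decays_MF
  exact sandwich_commutator bdd_Pker hC (by have := kappa166_pos 4; positivity) fmask_mul_self comp_Pker_MF_idM comp_MF_Pker_idM c y

/-- [our object] the same with the law supplied as a hypothesis on `divV V y`: (a4-total) ⟹ (W1). -/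
theorem w1_of_gauge_law {V : Fin 4 → Site 4 → MKer 4 (Fib 3)} {c : ℝ}
    (hA4 : ∀ y, divV V y = c • (comp MF (proj y) - comp (proj y) MF)) (y : Site 4) :
    comp (comp Pker (divV V y)) Pker = comp Pker ((-c) • proj y) - comp ((-c) • proj y) Pker := by
  rw [hA4 y]
  exact w1_gluon c y

end Gluon


/-! ## §5 [our object] The ghost instance: `A := G0ker = latticeGreen∕2`, `M := −Δ` (the explicit nearest-neighbour stencil), scalar fibre -/

section Ghost

open Literature.Probability.LatticeModels (latticeGreen latticeLaplacianZd latticeLaplacianZd_def latticeLaplacianZd_half_latticeGreen)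
open Summit.QuantumFields.BalabanUV.Beta.FP.PerfectPolarization (G0ker G0ker_apply)
open Summit.QuantumFields.BalabanUV.Beta.FP.PerfectPolarizationWard (bdd_G0ker)

/-- [our object] **MINUS THE LATTICE LAPLACIAN ON SCALARS, as a kernel on `ℤ⁴`**: `lapKer y z := 8·[z = y] − Σ_i ([z = y + e_i] + [z = y − e_i])`
(so `Σ_y f y·lapKer y z = 8 f z − Σ_i (f (z − e_i) + f (z + e_i)) = (−Δ f)(z)`). -/
def lapKer : MKer 4 Unit := fun y z _ _ =>
  8 * (if z = y then 1 else 0) - ∑ i : Fin 4, ((if z = y + Pi.single i 1 then (1 : ℝ) else 0) + (if z = y - Pi.single i 1 then 1 else 0))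

/-- [our object] entries of `lapKer`. -/
theorem lapKer_apply (y z : Site 4) (a b : Unit) : lapKer y z a b =
    8 * (if z = y then 1 else 0) - ∑ i : Fin 4, ((if z = y + Pi.single i 1 then (1 : ℝ) else 0) + (if z = y - Pi.single i 1 then 1 else 0)) := rfl

/-- [folklore] `|e_i|₁ = 1` on `ℤ⁴`. -/
theorem l1_single (i : Fin 4) : l1 (Pi.single i (1 : ℤ) : Site 4) = 1 := by
  unfold l1
  rw [Finset.sum_eq_single i]
  · simp
  · intro j _ hj; simp [hj]
  · intro h; exact absurd (Finset.mem_univ i) h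

/-- [folklore] `|−x|₁ = |x|₁`. -/
theorem l1_neg' (x : Site 4) : l1 (-x) = l1 x := by
  unfold l1; simp

/-- [our object] `lapKer` is symmetric under `(y, z) ↦ (z, y)`. -/
theorem lapKer_symm (y z : Site 4) (a b : Unit) : lapKer y z a b = lapKer z y b a := by
  rw [lapKer_apply, lapKer_apply]
  have e1 : (if z = y then (1 : ℝ) else 0) = if y = z then 1 else 0 := by
    by_cases h : z = y
    · simp [h]
    · simp [h, Ne.symm h]
  rw [e1]
  congr 1
  refine Finset.sum_congr rfl fun i _ => ?_
  have e2 : (if z = y + Pi.single i 1 then (1 : ℝ) else 0) = if y = z - Pi.single i 1 then 1 else 0 := by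
    by_cases h : z = y + Pi.single i 1
    · simp [h]
    · have : ¬ (y = z - Pi.single i 1) := fun h' => h (by rw [h']; abel)
      simp [h, this]
  have e3 : (if z = y - Pi.single i 1 then (1 : ℝ) else 0) = if y = z + Pi.single i 1 then 1 else 0 := by
    by_cases h : z = y - Pi.single i 1
    · simp [h]
    · have : ¬ (y = z + Pi.single i 1) := fun h' => h (by rw [h']; abel)
      simp [h, this]
  rw [e2, e3, add_comm]

/-- [our object] `lapKer` DECAYS (it is ultra-local: supported on `|y − z|₁ ≤ 1`): `Decays lapKer (16·e^{δ}) δ` for every `δ ≥ 0`. -/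
theorem decays_lapKer {δ : ℝ} (hδ : 0 ≤ δ) : Decays lapKer (16 * Real.exp δ) δ := by
  intro y z a b
  rw [lapKer_apply]
  have hbound : ∀ (P : Prop) [Decidable P] (v : Site 4), (P → z = v) → l1 (y - v) ≤ 1 →
      |(if P then (1 : ℝ) else 0)| ≤ Real.exp δ * Real.exp (-δ * l1 (y - z)) := by
    intro P _ v hv hl
    split_ifs with h
    · have hz := hv h
      subst hz
      rw [abs_one, ← Real.exp_add]
      apply Real.one_le_exp
      nlinarith
    · rw [abs_zero]; positivity
  have h0 := hbound (z = y) y (fun h => h) (by simp [l1])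
  have hp : ∀ i : Fin 4, |(if z = y + Pi.single i 1 then (1 : ℝ) else 0)| ≤ Real.exp δ * Real.exp (-δ * l1 (y - z)) :=
    fun i => hbound _ (y + Pi.single i 1) (fun h => h) (by rw [sub_add_cancel_left, l1_neg', l1_single])
  have hm : ∀ i : Fin 4, |(if z = y - Pi.single i 1 then (1 : ℝ) else 0)| ≤ Real.exp δ * Real.exp (-δ * l1 (y - z)) :=
    fun i => hbound _ (y - Pi.single i 1) (fun h => h) (by rw [sub_sub_cancel, l1_single])
  calc |8 * (if z = y then (1 : ℝ) else 0) - ∑ i : Fin 4, ((if z = y + Pi.single i 1 then (1 : ℝ) else 0) + (if z = y - Pi.single i 1 then 1 else 0))|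
      ≤ |8 * (if z = y then (1 : ℝ) else 0)| + |∑ i : Fin 4, ((if z = y + Pi.single i 1 then (1 : ℝ) else 0) + (if z = y - Pi.single i 1 then 1 else 0))| :=
        abs_sub _ _
    _ ≤ 8 * (Real.exp δ * Real.exp (-δ * l1 (y - z))) + ∑ _i : Fin 4, 2 * (Real.exp δ * Real.exp (-δ * l1 (y - z))) := by
        refine add_le_add ?_ ((Finset.abs_sum_le_sum_abs _ _).trans (Finset.sum_le_sum fun i _ => ?_))
        · rw [abs_mul, show |(8 : ℝ)| = 8 by norm_num]; exact mul_le_mul_of_nonneg_left h0 (by norm_num)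
        · exact (abs_add_le _ _).trans (by linarith [hp i, hm i])
    _ = 16 * Real.exp δ * Real.exp (-δ * l1 (y - z)) := by
        simp only [Finset.sum_const, Finset.card_univ, Fintype.card_fin, nsmul_eq_mul]; push_cast; ring

/-- [folklore] acting to the RIGHT: `Σ'_y f y·lapKer y z = 8 f z − Σ_i (f (z − e_i) + f (z + e_i))` for ANY `f` (finitely supported summand). -/
theorem tsum_mul_lapKer (f : Site 4 → ℝ) (z : Site 4) (a b : Unit) :
    ∑' y, f y * lapKer y z a b = 8 * f z - ∑ i : Fin 4, (f (z - Pi.single i 1) + f (z + Pi.single i 1)) := by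
  have e : ∀ y, f y * lapKer y z a b = 8 * (if y = z then f z else 0)
      - ∑ i : Fin 4, ((if y = z - Pi.single i 1 then f (z - Pi.single i 1) else 0) + (if y = z + Pi.single i 1 then f (z + Pi.single i 1) else 0)) := by
    intro y
    rw [lapKer_apply, mul_sub, Finset.mul_sum]
    congr 1
    · by_cases h : y = z
      · subst h; simp [mul_comm]
      · simp [h, Ne.symm h]
    · refine Finset.sum_congr rfl fun i _ => ?_
      rw [mul_add]
      congr 1
      · by_cases h : y = z - Pi.single i 1
        · subst h; simp
        · have : ¬ (z = y + Pi.single i 1) := fun h' => h (by rw [h']; abel)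
          simp [h, this]
      · by_cases h : y = z + Pi.single i 1
        · subst h; simp
        · have : ¬ (z = y - Pi.single i 1) := fun h' => h (by rw [h']; abel)
          simp [h, this]
  simp_rw [e]
  have h1 : HasSum (fun y : Site 4 => 8 * (if y = z then f z else 0)) (8 * f z) := (hasSum_ite_eq z (f z)).mul_left 8
  have h2 : HasSum (fun y : Site 4 => ∑ i : Fin 4, ((if y = z - Pi.single i 1 then f (z - Pi.single i 1) else 0)
      + (if y = z + Pi.single i 1 then f (z + Pi.single i 1) else 0))) (∑ i : Fin 4, (f (z - Pi.single i 1) + f (z + Pi.single i 1))) :=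
    hasSum_sum fun i _ => (hasSum_ite_eq _ _).add (hasSum_ite_eq _ _)
  exact (h1.sub h2).tsum_eq

/-- [folklore] acting to the LEFT: `Σ'_z lapKer y z·g z = 8 g y − Σ_i (g (y + e_i) + g (y − e_i))`. -/
theorem tsum_lapKer_mul (g : Site 4 → ℝ) (y : Site 4) (a b : Unit) :
    ∑' z, lapKer y z a b * g z = 8 * g y - ∑ i : Fin 4, (g (y - Pi.single i 1) + g (y + Pi.single i 1)) := by
  have e : ∀ z, lapKer y z a b * g z = g z * lapKer z y b a := fun z => by rw [lapKer_symm]; ring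
  simp_rw [e]
  exact tsum_mul_lapKer g y b a

/-- [our object] **(G-INV): `G0ker ∘ (−Δ) = id` AND `(−Δ) ∘ G0ker = id`** on the scalar fibre of `ℤ⁴` — lit1's Poisson equation
`LatticeGreenPoisson.latticeLaplacianZd_half_latticeGreen` (`Δ(latticeGreen∕2) = −δ₀`, `d = 4 ≥ 3`) read through `G0ker x z = latticeGreen (z − x)∕2`. -/
theorem gInv : comp G0ker lapKer = idM (fun _ => (1 : ℝ)) ∧ comp lapKer G0ker = idM (fun _ => (1 : ℝ)) := by
  have key : ∀ x z : Site 4, 8 * (latticeGreen (z - x) / 2)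
      - ∑ i : Fin 4, (latticeGreen (z - Pi.single i 1 - x) / 2 + latticeGreen (z + Pi.single i 1 - x) / 2) = if x = z then 1 else 0 := by
    intro x z
    have h := latticeLaplacianZd_half_latticeGreen 4 (by norm_num) (z - x)
    rw [latticeLaplacianZd_def] at h
    have e1 : ∀ i : Fin 4, z - x + Pi.single i 1 = z + Pi.single i 1 - x := fun i => by abel
    have e2 : ∀ i : Fin 4, z - x - Pi.single i 1 = z - Pi.single i 1 - x := fun i => by abel
    simp_rw [e1, e2] at h
    have e3 : (if x = z then (1 : ℝ) else 0) = if z - x = 0 then 1 else 0 := by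
      by_cases hx : x = z
      · simp [hx]
      · have : ¬ (z - x = 0) := fun e => hx (sub_eq_zero.mp e).symm
        simp [hx, this]
    rw [e3]
    have e4 : ∑ i : Fin 4, (latticeGreen (z - Pi.single i 1 - x) / 2 + latticeGreen (z + Pi.single i 1 - x) / 2)
        = ∑ i : Fin 4, (latticeGreen (z + Pi.single i 1 - x) / 2 + latticeGreen (z - Pi.single i 1 - x) / 2) :=
      Finset.sum_congr rfl fun i _ => add_comm _ _
    rw [e4]
    push_cast at h
    linarith
  constructor
  · funext x z a b
    show (∑' y, ∑ f, G0ker x y a f * lapKer y z f b) = idM (fun _ => (1 : ℝ)) x z a b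
    simp_rw [Fintype.sum_unique, G0ker_apply]
    rw [tsum_mul_lapKer (fun y => latticeGreen (y - x) / 2) z, idM_apply]
    simp only [and_true]
    rw [← key x z]
  · funext x z a b
    show (∑' y, ∑ f, lapKer x y a f * G0ker y z f b) = idM (fun _ => (1 : ℝ)) x z a b
    simp_rw [Fintype.sum_unique, G0ker_apply]
    rw [tsum_lapKer_mul (fun y => latticeGreen (z - y) / 2) x, idM_apply]
    simp only [and_true]
    rw [← key x z]
    have e1 : ∀ i : Fin 4, z - (x - Pi.single i 1) = z + Pi.single i 1 - x := fun i => by abel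
    have e2 : ∀ i : Fin 4, z - (x + Pi.single i 1) = z - Pi.single i 1 - x := fun i => by abel
    simp_rw [e1, e2]
    rw [Finset.sum_congr rfl fun i _ => add_comm _ _]

/-- [our object] the unit mask is idempotent. -/
theorem one_mask_mul_self : ∀ _a : Unit, (1 : ℝ) * 1 = 1 := fun _ => one_mul 1

/-- [our object] the scalar site projection `ΠU y := projM 1 y` is bi-localised at `(y, y)`. -/
theorem biLoc_projU (y : Site 4) (δ : ℝ) : BiLoc (projM (fun _ : Unit => (1 : ℝ)) y) y y 1 δ :=
  biLoc_projM (fun _ => by rw [abs_one]) y δ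

/-- [our object] **(W1) FOR THE GHOST SECTOR FROM THE COMMUTATOR LAW**: `(G0ker ∘ c·((−Δ) ∘ Π_y − Π_y ∘ (−Δ))) ∘ G0ker = G0ker ∘ (−c·Π_y) − (−c·Π_y) ∘ G0ker`. -/
theorem w1_ghost (c : ℝ) (y : Site 4) :
    comp (comp G0ker (c • (comp lapKer (projM (fun _ : Unit => (1 : ℝ)) y) - comp (projM (fun _ : Unit => (1 : ℝ)) y) lapKer))) G0ker
      = comp G0ker ((-c) • projM (fun _ : Unit => (1 : ℝ)) y) - comp ((-c) • projM (fun _ : Unit => (1 : ℝ)) y) G0ker :=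
  sandwich_commutator bdd_G0ker (decays_lapKer zero_le_one) one_pos (fun _ => one_mul 1) gInv.1 gInv.2 c y

end Ghost


/-! ## §6 THE LETTER (W1) DISCHARGED IN BOTH SECTORS: Ward transversality of `flipK PiBF` from the gauge-commutator laws -/

section Ward

open OneStepResolventKernel (Fib)
open PolarizationSign (WardTransversal)
open ExpKernelCalculus (shiftK)
open KernelWard (divV divW)
open Summit.QuantumFields.BalabanUV.Beta.FP.PerfectPolarization (Pker G0ker PiBF)
open Summit.QuantumFields.BalabanUV.Beta.FP.PerfectPropagatorInverse (MF)
open Summit.QuantumFields.BalabanUV.Beta.FP.PerfectPolarizationWard (wardTransversal_flip_PiBF)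

/-- [our object] the scalar-fibre site projection `ΠU y := projM 1 y`. -/
def projU (y : Site 4) : MKer 4 Unit := projM (fun _ : Unit => (1 : ℝ)) y

/-- [our object] `projU y = projM 1 y`. -/
theorem projU_def (y : Site 4) : projU y = projM (fun _ : Unit => (1 : ℝ)) y := rfl

omit [Fintype Φ] [DecidableEq Φ] in
/-- [folklore] scaling a bi-localised kernel scales its constant. -/
theorem biLoc_smul {K : MKer D Φ} {p q : Site D} {C δ : ℝ} (h : BiLoc K p q C δ) (c : ℝ) : BiLoc (c • K) p q (|c| * C) δ := by
  intro x z a b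
  have := h x z a b
  simp only [Pi.smul_apply, smul_eq_mul, abs_mul]
  calc |c| * |K x z a b| ≤ |c| * (C * Real.exp (-δ * (l1 (x - p) + l1 (z - q)))) := mul_le_mul_of_nonneg_left this (abs_nonneg _)
    _ = |c| * C * Real.exp (-δ * (l1 (x - p) + l1 (z - q))) := by ring

/-- [our object] **`WardTransversal (flipK PiBF)` WITH (W1) DISCHARGED** — the (K0)-socket's Ward letter for the BF perfect polarization over vertex data that is bi-localised at the
unit-lattice bonds, translation covariant, and GAUGE COVARIANT in the commutator form: (a4-total) `divV V y = c·(MF ∘ Π_y − Π_y ∘ MF)` (the divergence of the total cubic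
family is the commutator of the perfect Feynman form with the site projection), (a8) `divW W y ν y′ = X_y ∘ V ν y′ − V ν y′ ∘ X_y` with THE SAME generator `X_y = −c·Π_y`;
ghost sector likewise against `−Δ` (`lapKer`) and `ΠU`.  W2's remaining displayed letter (W1) is supplied by `w1_of_gauge_law` ∕ `w1_ghost` ((P-INV) ✓, (G-INV) ✓). -/
theorem wardTransversal_flip_PiBF_of_gauge_laws (wg wgh : ℝ)
    {V : Fin 4 → Site 4 → MKer 4 (Fib 3)} {W : Fin 4 → Site 4 → Fin 4 → Site 4 → MKer 4 (Fib 3)}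
    {v : Fin 4 → Site 4 → MKer 4 Unit} {w : Fin 4 → Site 4 → Fin 4 → Site 4 → MKer 4 Unit} {Cv Cw Cv' Cw' δ c cg : ℝ} (hδ : 0 < δ)
    (hV : ∀ (μ : Fin 4) (y : Site 4), BiLoc (V μ y) y y Cv δ) (hW : ∀ (μ : Fin 4) (y : Site 4) (ν : Fin 4) (y' : Site 4), BiLoc (W μ y ν y') y y' Cw δ)
    (hcovV : ∀ (μ : Fin 4) (y t : Site 4), V μ (y + t) = shiftK (-t) (V μ y))
    (hcovW : ∀ (μ : Fin 4) (y : Site 4) (ν : Fin 4) (y' t : Site 4), W μ (y + t) ν (y' + t) = shiftK (-t) (W μ y ν y'))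
    (hA4 : ∀ y, divV V y = c • (comp MF (proj y) - comp (proj y) MF))
    (hA8 : ∀ y ν y', divW W y ν y' = comp ((-c) • proj y) (V ν y') - comp (V ν y') ((-c) • proj y))
    (hv : ∀ (μ : Fin 4) (y : Site 4), BiLoc (v μ y) y y Cv' δ) (hw : ∀ (μ : Fin 4) (y : Site 4) (ν : Fin 4) (y' : Site 4), BiLoc (w μ y ν y') y y' Cw' δ)
    (hcovv : ∀ (μ : Fin 4) (y t : Site 4), v μ (y + t) = shiftK (-t) (v μ y))
    (hcovw : ∀ (μ : Fin 4) (y : Site 4) (ν : Fin 4) (y' t : Site 4), w μ (y + t) ν (y' + t) = shiftK (-t) (w μ y ν y'))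
    (hA4g : ∀ y, divV v y = cg • (comp lapKer (projU y) - comp (projU y) lapKer))
    (hA8g : ∀ y ν y', divW w y ν y' = comp ((-cg) • projU y) (v ν y') - comp (v ν y') ((-cg) • projU y)) :
    WardTransversal (fun μ ν z => PiBF wg wgh V W v w μ ν (-z)) :=
  wardTransversal_flip_PiBF wg wgh hδ hV hW hcovV hcovW (fun y => (-c) • proj y) (fun y => biLoc_smul (biLoc_proj y δ) (-c))
    (fun y => w1_of_gauge_law hA4 y) hA8 hv hw hcovv hcovw (fun y => (-cg) • projU y) (fun y => biLoc_smul (biLoc_projU y δ) (-cg))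
    (fun y => by rw [hA4g y]; exact w1_ghost cg y) hA8g

end Ward

end Summit.QuantumFields.BalabanUV.Beta.FP.PerfectPolarizationWardLetters

end
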